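import Summits.AtomisticToContinuum.Crystallization.Theorems.FrustratedLawDichotomyStrainedPatchGaugeCells

/-!
(SPLIT FOR THE 400-LINE CAP by the landing lane, hand-2 g30: this file = part 1 of 3; sequels `…FrustratedLawDichotomyStrainedPatchFrameCellsB`, `…FrustratedLawDichotomyStrainedPatchFrameCells` import it in a chain; same namespace, all FQNs unchanged.)
# FRAME CELLS: the 27623 cell census in POSITION (frame) currency — exact riding keeps orientation — and the HOLE TEST (decomp-a2c lens-5 g65)

Target of record (61H, tree `…StrainedPatchHostCells`): `[CORE-FAR] ⟸ TubeP ∧ CoverP`, `TubeP := TubeFloor FamP (1/80)`, gauge-fixed by 63G (tree `…GaugeCells`) to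
`TubeFloor (FamG WSym) (1/80)`; 62B cut the family into EXACT cells `ExactCert := ∀ k G ξ b, … → FatTubeFloor (bendAt b (N.ref k G ξ)) (N.c k) (1/80) 0 0` (bond currency,
pair tolerance `2τ = 1/40`), and 63G §3 / g64 typed the census's DEAD certificates over `Charted z₁ c₁ τ 0 0` (bond currency again).

THE OBSERVATION.  The hypothesis of (TF) `TubeFloor 𝓘 τ` is `ChartBy 𝓘 τ τ z c z₀ c₀ e` — a POSITION chart IN ONE FRAME: every `63/10`-ball site's position RELATIVE TO
THE CENTRE is within `τ` of its label's position relative to `c₀`, as a VECTOR.  61H §1 passed to BOND currency (`BondChart`: pair distances within `2τ`, `bond_dev_le`)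
because a cell `NearRef z₁ c₁ κ lam τ` of instances near a reference is naturally a bond-level notion — «a NearRef chart forgets orientation».  At EXACT riding
(`κ = lam = 0`, the 62B interface) the passage is LOSSY AND UNNECESSARY: an instance presented by `(φ, b₀, G, ξ)` has relative position vectors EQUAL to those of the
bent symbolic reference (`h a − h c₀ = b₀ (z₀ a − z₀ c₀)` is the presentation itself), so the cluster is frame-charted BY THE REFERENCE with the SAME tolerance `τ`:
the orientation of every coordination shell is retained and the tolerance is not doubled.  This node re-cuts the cells in that currency and supplies the dead-cell
certificate that uses orientation.

## THE NODE (every junction PROVED, 0 sorry; imports ONLY the tree module `…StrainedPatchGaugeCells`)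

**§1 FRAME CELLS.**  `FrameChart τ z c z₁ c₁ e'` (centre to centre, relative positions within `τ`, injective on the ball, covering the reference `6`-ball),
`FrameCharted`, (FTᶠ) `FrameTubeFloor z₁ c₁ τ`, `FrameDeadRef`.  ★ frame ⟹ bond: `bondChart_of_frameChart` (`BondChart τ 0 0`), `charted_of_frameCharted`
(`Charted z₁ c₁ τ 0 0`), hence (FT) ⟹ (FTᶠ) `frameTubeFloor_of_fatTubeFloor` and bond-DEAD ⟹ frame-DEAD `frameDeadRef_of_deadRef`: the 60A energy certificate and
every 63G/g64 witness ((R12), (N13), (K13), Tight, Core) still discharge their cells (`frameTubeFloor_of_status`).  `FrameCharted.vec`: every difference VECTOR of two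
ball sites is read off the reference up to `2τ`.

**§2 EXACT RIDING IS A FRAME RELATION.**  `RidesOn z₁ c₁ τ M₀ h c₀` (a labelling under which the instance's `(63/10+τ)`-ball sites have THE SAME position vectors
relative to the centre as their labels; injective; covering); ★ `frameChart_of_chartBy_of_ridesOn` — `ChartBy` (tolerance `τ`) ∘ `RidesOn` = `FrameChart` with the SAME
`τ` (compare 61H `bondChart_of_chartBy_of_nearRef`: `2τ`, orientation lost); ★★ `tubeFloor_frameCell` (ONE frame certificate decides the tube floor over the cell
`𝓘 ⊓ RidesOn z₁ c₁ τ`); cells indexed by ANY type (`InFrameCells`, (ECᶠ) `FrameCellsCert`, ★★ `tubeFloor_of_frameCells_of_remainder`, `tubeFloor_of_frameCells`,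
`frameCellsCert_of_fat`); ★★ `ridesOn_of_presentedBy` — 62B's exact riding in frame currency over TREE notions (`PresentedBy`, `latSet`, `bends0`): an injective
instance presented on the `133/10`-window rides on every reference listing its bent lattice window (`w` injective, `w c₁ = 0`, `‖w‖ ≤ 14`, complete below norm `10` —
62B's `N.GoodAt k G ξ`); `ridesOn_self` [V2: `RidesOn` is satisfiable].  **§2b ABSTRACT RIDING NETS** (tree-only interface that 62B's HOME-only `SymNet` instantiates
DEFINITIONALLY: `R := N.ref`, `netRef R c k G ξ b = bendAt b (N.ref k G ξ) (N.c k)` by `rfl`): `NetGood φ R c P` (= `CellsGood` with injectivity for separation ∧ lattice membership), (ECᶠᴺ)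
`FrameNetCert R c P 𝓑 τ`, `BoxesCoverW φ P 𝒲` (= 62B `BoxesCover`); ★★ `famLE_inFrameNetCells` — (EVᶠᴺ) PROVED for the gauge family `FamG 𝒲`; ★★★
`tubeFloor_famG_of_frameNet`, `tubeP_of_frameNet` (any `Rotatable 𝒲`, 63G) and `tubeP_of_frameNet_WSym : NetGood φ R c P → FrameNetCert R c P bends0 (1/80) →
BoxesCoverW φ P WSym → TubeP` — (TF)ᴾ from frame cells with NO remainder, NO slots, NO bond conversion; `frameNetCert_of_status` (each cell by energy / bond-dead /
frame-dead).  Rev 3 (satisfiability, V2): `exists_wSym_latSet_norm_lt` — `WSym` contains hcp parameters (`U = 3/4`, `ξ = −hcpShift/4`) with a nonzero lattice vector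
of norm `9/16 < 7/10`, so `NetGood` asks INJECTIVITY of the listing, not `7/10`-separation (which would make `NetGood ∧ BoxesCoverW φ P WSym` unsatisfiable — rev 2's
defect); the non-separated cells host no admissible instance: `frameDeadRef_of_close` (§1).

**§3 THE HOLE TEST.**  `FrameLooseWitness z₁ c₁ τ a₁` (the label `a₁` is never `1/8`-good in a frame-charted cluster; WEAKER than 63G's `LooseWitness … τ 0 0 a₁`:
`frameLooseWitness_of_looseWitness`) ⟹ `frameDeadRef_of_frameLooseWitness` (cover + `CleanBall`).  ★★★ (HT) `HoleAt P z₁ c₁ a₁ τ` — REFERENCE-LEVEL, DECIDABLE per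
cell, ORIENTATION-AWARE: for every candidate centre `q₀ ∈ B(z₁ a₁, τ)`, scale `0 < d ≤ 3/2` and linear isometry `A` PINNED by the reference (`d ≤ d(z₁ b, q₀) + τ` for the
other sites of the `6`-ball, `d(z₁ b, q₀) ≤ d + τ` for one), SOME vertex `q₀ + d·A(P u)` has no other reference site within `d/8 + τ`.  ★★★ `no_fit_of_holeAt`: (HT) +
room ⟹ no frame-charted cluster has a `P`-fit with misfit `< 1/8` at the label `a₁` (the fit read through the chart IS a pinned candidate whose twelve vertices are
occupied within `ηd + τ`; the frame clause at the shell sites is the vector statement that bond currency lacks); `frameLooseWitness_of_holeAt` (both patterns,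
`goodAtScale_iff_fcc_or_hcp`), ★★★ `frameDeadRef_of_holeAt`, `frameTubeFloor_of_holeAt`.  (HT₀) `FixedHoleAt` (centre frozen at `z₁ a₁`, tolerances doubled; `4`
parameters `(d, A)`) ⟹ (HT) `holeAt_of_fixedHoleAt`.  ★★ `holeAt_of_fewNear`: g64's (R12) count (literally `…ShellWitness.FewNear z₁ a₁ (9/8·(ρ₁+2τ)+2τ) 12` unfolded)
⟹ (HT), given `14τ ≤ 3 m₁` — the frame instrument decides AT LEAST the cells the radial count decides.

## NUMBERS (memo §3; `τ = 1/80`, `d ≈ ρ₁ ≈ 1`)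

Currency: `m^(τ)(a₁)` := the least, over PINNED candidates `(q₀, d, A)` with `q₀ ∈ B(z₁ a₁, τ)`, of `max_u min_{b ≠ a₁} ‖z₁ b − (q₀ + d·A(P u))‖ / d` — the
reference's own centre-constrained sup-misfit at `a₁` (both patterns).  (HT) ⟺ `m^(τ) ≥ 1/8 + τ/d` (= `0.1375`) BY DEFINITION, and `no_fit_of_holeAt` read
contrapositively says LIVE ⟹ `m^(τ) < 1/8 + τ/d`: the hole test IS the dead/live interface of the frame cell, ISOTROPIC (radial and angular distortion count alike), up
to the cluster-side freedom (a frame-`τ`-perturbation of the reference with an admissible completion can lower the misfit by `≲ 3τ/d`): undecided collar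
`m^(τ) ∈ [1/8 − 3τ/d, 1/8 + τ/d)` = `[0.0875, 0.1375)`, to be resolved only by the energy certificate.  (HT₀): dead ⟸ `m^(τ) ≥ 1/8 + 3τ/d = 0.1625`.  (R12) (g64): dead ⟸
the twelfth-nearest other site lies beyond `9/8·ρ₁ + 17/320`: RADIAL deviations only (`0.178` radial; a twisted shell — tangential displacements, radii exact — is
never (R12)-dead; on radial-signature distortions (R12) is the radial shadow of (HT) and nearly as strong; toy numbers in memo §3: hcp shuffle `|ξ|` dead from
`≈ 0.13` (HT) vs `0.18–0.22` (R12), simple shear `ε` from `≈ 0.085` vs `0.10`).  The bond-currency mirror leaf (K13-hi) of critic row 1106: wall `1/8 + (2c + 1/4)τ ∈ [0.166, 0.178]` CONDITIONAL on the uncalibrated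
13-point rigidity constant `c ∈ [3/2, 2)` and one semialgebraic certificate per cell — DOMINATED by (HT) (sharper, constant-free, leaf-free), hence recorded (memo §1)
and not typed.  DEAD-lo (a TIGHT frame witness) is VACUOUS at `τ = 1/80`: a frame-`τ` chart moves difference vectors by up to `2τ` and re-pins the scale by up to
`2τ`, so forcing a `1/20`-fit at the label in EVERY charted cluster needs reference misfit `< 1/20 − ≈4τ/d < 0` (g63's recorded dead end); g64's bond tight bridge
(K13-inst, margin `η₁ < 1.1 %`) remains the only inner wall and is not repeated here.

PIECES AND TAGS.  `TubeP` [61H (TF)ᴾ] ⟸ (63G gauge, `tubeP_of_tubeG_of_rotatable` · PROVED) `TubeFloor (FamG WSym) (1/80)` ⟸ (`tubeFloor_famG_of_frameNet` · PROVED)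
`NetGood φ R c P` [ELEMENTARY · census-checkable; = 62B `CellsGood` with injectivity in place of separation (rev 3)] ∧ (ECᶠᴺ) `FrameNetCert R c P bends0 (1/80)` [one (FTᶠ) per cell · INSTRUMENTABLE] ∧ `BoxesCoverW φ P WSym`
[ELEMENTARY · finite-dimensional]; generically `TubeFloor 𝓘 τ` ⟸ (ECᶠ) `FrameCellsCert Z C τ` ∧ (EVᶠ) `FamilyLE 𝓘 (InFrameCells Z C τ)` (or ∧ the remainder's tube floor),
with (EVᶠᴺ) `famLE_inFrameNetCells` PROVED for `FamG 𝒲`.  Per cell (FTᶠ) ⟸ frame-DEAD [VACUOUS] ∨ bond-DEAD [63G/g64 certificates] ∨ (FT) [60A energy certificate · INSTRUMENTABLE];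
frame-DEAD ⟸ (HT)_fcc ∧ (HT)_hcp at ONE label of the `6`-ball with room [SEMIALGEBRAIC on the reference · DECIDABLE · PROVED junction · INSTRUMENTABLE ← a
`7`-parameter (`6` effective: the pins confine `d` to width `2τ`) branch-and-bound per label, clearance `1`-Lipschitz in `(q₀, d, d·A)`] ⟸ (HT₀) [`4` parameters] or ⟸ (R12).
WHY EACH PIECE IS STRICTLY WEAKER than the target: each floors ONE reference; (HT) speaks of one finite configuration and two 12-point patterns — nothing of HR39,
admissibility, the score or the census.  WHY NOVEL (w.r.t. 61H–63G, g64 and the tree): the whole cell tower is in bond currency by design; the tree's position-currency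
rigidity (`TwoShellRigidity`, KR18) pays `4τ` through the link window (g63's recorded dead end); here NO rigidity theorem is used — the chart itself carries the frame,
exact riding transports it for free, and the dead certificate is a HOLE, not a constant.  NOT COSTUME: no decl restates (TF), (FT), `TubeP` or a refuted statement;
(HT) is named, reference-level, with its exact wall.  V1/V2 (critic row 1109): no hypothesis has the coercivity-over-a-class shape (V1 n/a); V2: `ridesOn_self`
(kernel), `FrameCharted ⟹ Charted` (witnessed with `Charted` by the census's live cells), the pins of (HT) are met by `(z₁ a₁, ρ₁(a₁), 1)` on every reference with a
neighbour within `3/2` (never vacuously true), and (HT) FAILS at the centre of a perfect 13-site star while it HOLDS on a lacunary toy reference (kernel `example`s,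
`MustFail65.lean`).  KILL: the junctions cannot be refuted (proved); the node is USELESS iff the census finds `#((HT)-dead ∖ ((R12) ∪ (N13))-dead)` below `5 %` of the
box cells — then frame currency buys nothing and 62B's bond cells stand unchanged.  Tree-only imports; no `sorry`; standard axioms; no instances / notation / options.
-/

noncomputable section

namespace Summit.AtomisticToContinuum.Crystallization.Theorems.FrustratedLawDichotomyStrainedPatchFrameCells

open scoped BigOperators Classical RealInnerProductSpace
open Literature.Geometry.DiscreteGeometry (fccKissingPattern hcpKissingPattern card_fccKissingPattern card_hcpKissingPattern
  norm_eq_one_of_mem_fccKissingPattern norm_eq_one_of_mem_hcpKissingPattern one_le_dist_of_mem_fccKissingPattern one_le_dist_of_mem_hcpKissingPattern)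
open Summit.AtomisticToContinuum.Crystallization.Theorems.FrustratedLawDichotomyPeriodicBlockFlags (goodAtScale_mono)
open Summit.AtomisticToContinuum.Crystallization.Theorems.FrustratedLawDichotomyRangeCut (Sep)
open Summit.AtomisticToContinuum.Crystallization.Theorems.FrustratedLawDichotomyMotifLemmas
open Summit.AtomisticToContinuum.Crystallization.Theorems.FrustratedLawDichotomyAveragingCut
open Summit.AtomisticToContinuum.Crystallization.Theorems.FrustratedLawDichotomyAveragingRuleCap
open Summit.AtomisticToContinuum.Crystallization.Theorems.FrustratedLawDichotomyAveragingRuleTightFree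
open Summit.AtomisticToContinuum.Crystallization.Theorems.FrustratedLawDichotomyExemptDoor (SitePred)
open Summit.AtomisticToContinuum.Crystallization.Theorems.FrustratedLawDichotomyExemptAbsorption
open Summit.AtomisticToContinuum.Crystallization.Theorems.FrustratedLawDichotomyExemptAbsorptionRecord
open Summit.AtomisticToContinuum.Crystallization.Theorems.FrustratedLawDichotomyCollarCensus
open Summit.AtomisticToContinuum.Crystallization.Theorems.FrustratedLawDichotomyCollarCensusKappa
open Summit.AtomisticToContinuum.Crystallization.Theorems.FrustratedLawDichotomyStrainedPatchHomSplit
open Summit.AtomisticToContinuum.Crystallization.Theorems.FrustratedLawDichotomyStrainedPatchCleanCollar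
open Summit.AtomisticToContinuum.Crystallization.Theorems.FrustratedLawDichotomyStrainedPatchHomTube
open Summit.AtomisticToContinuum.Crystallization.Theorems.FrustratedLawDichotomyStrainedPatchHomPolar
open Summit.AtomisticToContinuum.Crystallization.Theorems.FrustratedLawDichotomyStrainedPatchHomIsometry
open Summit.AtomisticToContinuum.Crystallization.Theorems.FrustratedLawDichotomyStrainedPatchHomTubeIso
open Summit.AtomisticToContinuum.Crystallization.Theorems.FrustratedLawDichotomyStrainedPatchPhaseCut
open Summit.AtomisticToContinuum.Crystallization.Theorems.FrustratedLawDichotomyStrainedPatchCoreTube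
open Summit.AtomisticToContinuum.Crystallization.Theorems.FrustratedLawDichotomyStrainedPatchCoreTubeRecord
open Summit.AtomisticToContinuum.Crystallization.Theorems.FrustratedLawDichotomyStrainedPatchCoreTubeMilli
open Summit.AtomisticToContinuum.Crystallization.Theorems.FrustratedLawDichotomyStrainedPatchStrainBands
open Summit.AtomisticToContinuum.Crystallization.Theorems.FrustratedLawDichotomyStrainedPatchChartFamilies
open Summit.AtomisticToContinuum.Crystallization.Theorems.FrustratedLawDichotomyStrainedPatchChartFamiliesBent
open Summit.AtomisticToContinuum.Crystallization.Theorems.FrustratedLawDichotomyStrainedPatchChartFamiliesPinned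
open Summit.AtomisticToContinuum.Crystallization.Theorems.FrustratedLawDichotomyStrainedPatchRecutPairs
open Summit.AtomisticToContinuum.Crystallization.Theorems.FrustratedLawDichotomyStrainedPatchRecutKinematics
open Summit.AtomisticToContinuum.Crystallization.Theorems.FrustratedLawDichotomyStrainedPatchWindowFamilies
open Summit.AtomisticToContinuum.Crystallization.Theorems.FrustratedLawDichotomyStrainedPatchHostCells
open Summit.AtomisticToContinuum.Crystallization.Theorems.FrustratedLawDichotomyStrainedPatchGaugeCells

/-! ## §1. FRAME CHARTS: the cluster charted by a reference in ONE FRAME (position currency, tolerance `τ` — the currency of `ChartBy` / (TF) itself) -/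

section Frame
variable {M₁ : ℕ} {z₁ : Fin M₁ → E3} {c₁ : Fin M₁} {τ τ' : ℝ} {M : ℕ} {z : Fin M → E3} {c : Fin M} {e' : Fin M → Fin M₁}

/-- **`FrameChart τ z c z₁ c₁ e'`** — the cluster `(z, c)` charted by the REFERENCE `(z₁, c₁)` IN ONE FRAME: centre to centre, every `63/10`-ball site's position
RELATIVE TO THE CENTRE within `τ` of its label's position relative to `c₁` (no rotation, no relabelling freedom), injective on the ball, covering the reference's
`6`-ball.  This is `ChartBy` with the family clause and the fine clause dropped and the instance replaced by the reference. -/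
def FrameChart (τ : ℝ) {M : ℕ} (z : Fin M → E3) (c : Fin M) {M₁ : ℕ} (z₁ : Fin M₁ → E3) (c₁ : Fin M₁) (e' : Fin M → Fin M₁) : Prop :=
  e' c = c₁ ∧
    (∀ a, dist (z a) (z c) ≤ 63 / 10 → dist (z a - z c) (z₁ (e' a) - z₁ c₁) ≤ τ) ∧
    (∀ a b, dist (z a) (z c) ≤ 63 / 10 → dist (z b) (z c) ≤ 63 / 10 → e' a = e' b → a = b) ∧
    (∀ b₁, dist (z₁ b₁) (z₁ c₁) ≤ 6 → ∃ a, dist (z a) (z c) ≤ 63 / 10 ∧ e' a = b₁)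

/-- **`FrameCharted z₁ c₁ τ M z c e'`** — an admissible, `63/10`-clean, `63/10`-mono-phase record cluster frame-charted by the reference. -/
def FrameCharted {M₁ : ℕ} (z₁ : Fin M₁ → E3) (c₁ : Fin M₁) (τ : ℝ) (M : ℕ) (z : Fin M → E3) (c : Fin M) (e' : Fin M → Fin M₁) : Prop :=
  Admissible M z c ∧ CleanBall (63 / 10) z c ∧ MonoPhaseBall (63 / 10) z c ∧ FrameChart τ z c z₁ c₁ e'

/-- **(FTᶠ) `FrameTubeFloor z₁ c₁ τ` [CERTIFICATE at ONE reference, frame currency · INSTRUMENTABLE]** — every admissible clean mono-phase record cluster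
frame-charted by the reference with tolerance `τ` scores `≥ 0`.  WEAKER than 61H's bond-currency (FT) `FatTubeFloor z₁ c₁ τ 0 0` (fewer clusters to floor:
`frameTubeFloor_of_fatTubeFloor`), and exactly what the tube floor (TF) asks of a cell at exact riding (`tubeFloor_frameCell`). -/
def FrameTubeFloor {M₁ : ℕ} (z₁ : Fin M₁ → E3) (c₁ : Fin M₁) (τ : ℝ) : Prop :=
  ∀ (M : ℕ) (z : Fin M → E3) (c : Fin M) (e' : Fin M → Fin M₁), Admissible M z c → CleanBall (63 / 10) z c → MonoPhaseBall (63 / 10) z c →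
    FrameChart τ z c z₁ c₁ e' → 0 ≤ ballAvg (9 / 5) z (xRec M z) c

/-- **`FrameDeadRef z₁ c₁ τ` [DEAD CELL, frame currency]** — NO record cluster is frame-charted by the reference: (FTᶠ) holds VACUOUSLY. -/
def FrameDeadRef {M₁ : ℕ} (z₁ : Fin M₁ → E3) (c₁ : Fin M₁) (τ : ℝ) : Prop :=
  ∀ (M : ℕ) (z : Fin M → E3) (c : Fin M) (e' : Fin M → Fin M₁), ¬FrameCharted z₁ c₁ τ M z c e'

/-- (FTᶠ) restated through `FrameCharted`. [formal bookkeeping] -/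
theorem frameTubeFloor_iff_charted (z₁ : Fin M₁ → E3) (c₁ : Fin M₁) (τ : ℝ) :
    FrameTubeFloor z₁ c₁ τ ↔ ∀ (M : ℕ) (z : Fin M → E3) (c : Fin M) (e' : Fin M → Fin M₁), FrameCharted z₁ c₁ τ M z c e' → 0 ≤ ballAvg (9 / 5) z (xRec M z) c :=
  ⟨fun h M z c e' hch => h M z c e' hch.1 hch.2.1 hch.2.2.1 hch.2.2.2, fun h M z c e' hz hcl hm hf => h M z c e' ⟨hz, hcl, hm, hf⟩⟩

/-- ★ A frame-DEAD reference is certified (vacuously). [formal bookkeeping] -/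
theorem frameTubeFloor_of_frameDeadRef (h : FrameDeadRef z₁ c₁ τ) : FrameTubeFloor z₁ c₁ τ :=
  fun M z c e' hz hcl hm hf => (h M z c e' ⟨hz, hcl, hm, hf⟩).elim

/-- ★ **FRAME ⟹ BOND**: a frame chart with tolerance `τ` is a bond chart with pair tolerance `2τ` (the `2τ` triangle inequality `bond_dev_le`), i.e. 61H's
`BondChart τ 0 0`. The converse fails (a bond chart forgets the orientation of every shell). [folklore] -/
theorem bondChart_of_frameChart (h : FrameChart τ z c z₁ c₁ e') : BondChart τ 0 0 z c z₁ c₁ e' := by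
  refine ⟨h.1, fun a b ha hb => ?_, h.2.2.1, h.2.2.2⟩
  have h₁ := bond_dev_le (h.2.1 a ha) (h.2.1 b hb)
  simpa only [zero_mul, add_zero] using h₁

/-- … hence a frame-charted cluster is `Charted z₁ c₁ τ 0 0` (63G). [formal bookkeeping] -/
theorem charted_of_frameCharted (h : FrameCharted z₁ c₁ τ M z c e') : Charted z₁ c₁ τ 0 0 M z c e' :=
  ⟨h.1, h.2.1, h.2.2.1, bondChart_of_frameChart h.2.2.2⟩

/-- ★★ **EVERY BOND CERTIFICATE DISCHARGES THE FRAME CELL**: 61H's (FT) at exact riding ⟹ (FTᶠ).  So the 60A energy certificate and all of 63G/g64's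
DEAD witnesses (`DeadRef z₁ c₁ τ 0 0` from (R12), (N13), (K13), `TightWitness`, `CoreWitness`) remain valid cell by cell. [folklore] -/
theorem frameTubeFloor_of_fatTubeFloor (h : FatTubeFloor z₁ c₁ τ 0 0) : FrameTubeFloor z₁ c₁ τ :=
  fun M z c e' hz hcl hm hf => h M z c e' hz hcl hm (bondChart_of_frameChart hf)

/-- ★ A bond-DEAD reference is frame-DEAD. [formal bookkeeping] -/
theorem frameDeadRef_of_deadRef (h : DeadRef z₁ c₁ τ 0 0) : FrameDeadRef z₁ c₁ τ :=
  fun M z c e' hf => h M z c e' (charted_of_frameCharted hf)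

/-- ★ **A reference with two `6`-ball labels closer than `7/10 − 2τ` is frame-DEAD** — a frame-charted admissible cluster would carry two distinct sites within
`7/10` of each other, against its hard core.  In particular every cell at window parameters where the lattice itself is not `7/10`-separated (the hcp corner
of `WSym`) is discharged by this one-line check; this is what lets `NetGood` ask injectivity only (rev 3). [formal bookkeeping] -/
theorem frameDeadRef_of_close {a a' : Fin M₁} (hne : a ≠ a') (ha : dist (z₁ a) (z₁ c₁) ≤ 6) (ha' : dist (z₁ a') (z₁ c₁) ≤ 6)
    (hclose : dist (z₁ a) (z₁ a') + 2 * τ < 7 / 10) : FrameDeadRef z₁ c₁ τ := by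
  rintro M z c e' ⟨hz, -, -, -, hdev, -, hcov⟩
  obtain ⟨x, hx, hxa⟩ := hcov a ha
  obtain ⟨x', hx', hxa'⟩ := hcov a' ha'
  have hxx : x ≠ x' := fun h => hne (by rw [← hxa, ← hxa', h])
  have h1 := hdev x hx
  have h2 := hdev x' hx'
  rw [hxa] at h1
  rw [hxa'] at h2
  have hsep := hz.2.1 x x' hxx
  have htri : dist (z x) (z x') ≤ dist (z₁ a) (z₁ a') + 2 * τ := by
    have e1 : dist (z x) (z x') = dist (z x - z c) (z x' - z c) := (dist_sub_right (z x) (z x') (z c)).symm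
    have e2 : dist (z₁ a) (z₁ a') = dist (z₁ a - z₁ c₁) (z₁ a' - z₁ c₁) := (dist_sub_right (z₁ a) (z₁ a') (z₁ c₁)).symm
    rw [e1, e2]
    rw [dist_comm] at h2
    linarith [dist_triangle4 (z x - z c) (z₁ a - z₁ c₁) (z₁ a' - z₁ c₁) (z x' - z c)]
  linarith

/-- The census's per-cell bookkeeping: frame-dead ∨ bond-dead ∨ bond-certified ⟹ (FTᶠ). [formal bookkeeping] -/
theorem frameTubeFloor_of_status (h : FrameDeadRef z₁ c₁ τ ∨ DeadRef z₁ c₁ τ 0 0 ∨ FatTubeFloor z₁ c₁ τ 0 0) : FrameTubeFloor z₁ c₁ τ := by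
  rcases h with h | h | h
  · exact frameTubeFloor_of_frameDeadRef h
  · exact frameTubeFloor_of_frameDeadRef (frameDeadRef_of_deadRef h)
  · exact frameTubeFloor_of_fatTubeFloor h

/-- Frame charts loosen with `τ`. [formal bookkeeping] -/
theorem FrameChart.mono (h : FrameChart τ z c z₁ c₁ e') (hle : τ ≤ τ') : FrameChart τ' z c z₁ c₁ e' :=
  ⟨h.1, fun a ha => (h.2.1 a ha).trans hle, h.2.2⟩

/-- `FrameCharted.mono` (docstring: see `FrameChart.mono`). [formal bookkeeping] -/
theorem FrameCharted.mono (h : FrameCharted z₁ c₁ τ M z c e') (hle : τ ≤ τ') : FrameCharted z₁ c₁ τ' M z c e' :=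
  ⟨h.1, h.2.1, h.2.2.1, h.2.2.2.mono hle⟩

/-- (FTᶠ) is ANTITONE in the tolerance. [formal bookkeeping] -/
theorem FrameTubeFloor.anti (h : FrameTubeFloor z₁ c₁ τ') (hle : τ ≤ τ') : FrameTubeFloor z₁ c₁ τ :=
  fun M z c e' hz hcl hm hf => h M z c e' hz hcl hm (hf.mono hle)

/-- Frame-DEAD is ANTITONE in the tolerance. [formal bookkeeping] -/
theorem FrameDeadRef.anti (h : FrameDeadRef z₁ c₁ τ') (hle : τ ≤ τ') : FrameDeadRef z₁ c₁ τ :=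
  fun M z c e' hf => h M z c e' (hf.mono hle)

/-- The frame-charted cluster is injective (admissibility). [formal bookkeeping] -/
theorem FrameCharted.injective (h : FrameCharted z₁ c₁ τ M z c e') : Function.Injective z := h.1.1

/-- ★ The FRAME READING: relative positions of `63/10`-ball sites are read off the reference up to `τ` — in particular EVERY difference vector of two ball sites
up to `2τ` (vector, not only length). [formal bookkeeping] -/
theorem FrameCharted.vec (h : FrameCharted z₁ c₁ τ M z c e') {a b : Fin M} (ha : dist (z a) (z c) ≤ 63 / 10) (hb : dist (z b) (z c) ≤ 63 / 10) :
    ‖(z a - z b) - (z₁ (e' a) - z₁ (e' b))‖ ≤ 2 * τ := by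
  have h₁ := h.2.2.2.2.1 a ha
  have h₂ := h.2.2.2.2.1 b hb
  rw [dist_eq_norm] at h₁ h₂
  have key : (z a - z b) - (z₁ (e' a) - z₁ (e' b)) = (z a - z c - (z₁ (e' a) - z₁ c₁)) - (z b - z c - (z₁ (e' b) - z₁ c₁)) := by abel
  calc ‖(z a - z b) - (z₁ (e' a) - z₁ (e' b))‖ = ‖(z a - z c - (z₁ (e' a) - z₁ c₁)) - (z b - z c - (z₁ (e' b) - z₁ c₁))‖ := by rw [key]
    _ ≤ ‖z a - z c - (z₁ (e' a) - z₁ c₁)‖ + ‖z b - z c - (z₁ (e' b) - z₁ c₁)‖ := norm_sub_le _ _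
    _ ≤ 2 * τ := by linarith

end Frame

/-! ## §2. EXACT RIDING IS A FRAME RELATION: the instance's relative position vectors ARE the reference's — the cell lemma in frame currency -/

section Cell
variable {𝓘 : (M₀ : ℕ) → (Fin M₀ → E3) → Fin M₀ → Prop} {τ t : ℝ} {M : ℕ} {z : Fin M → E3} {c : Fin M} {M₀ : ℕ} {h : Fin M₀ → E3} {c₀ : Fin M₀}
  {e : Fin M → Fin M₀} {M₁ : ℕ} {z₁ : Fin M₁ → E3} {c₁ : Fin M₁}

/-- **`RidesOn z₁ c₁ τ M₀ h c₀`** — the instance `(h, c₀)` RIDES EXACTLY on the reference `(z₁, c₁)`: a labelling `f`, centre to centre, under which every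
site of the instance's `(63/10 + τ)`-ball has THE SAME position relative to `h c₀` as its label relative to `z₁ c₁` (an equality of vectors, not of distances),
injective there, covering the reference's `6`-ball by the instance's `(63/10 − τ)`-ball.  62B's exact cells satisfy it: an instance presented by `(φ, b₀, G, ξ)`
rides on the bent symbolic reference `bendAt b₀ (N.ref k G ξ)` (`ridesOn_of_presentedBy` below); 62B recorded only the bond shadow `NearRefA … 0 0 τ`. -/
def RidesOn {M₁ : ℕ} (z₁ : Fin M₁ → E3) (c₁ : Fin M₁) (τ : ℝ) : (M₀ : ℕ) → (Fin M₀ → E3) → Fin M₀ → Prop :=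
  fun M₀ h c₀ => ∃ f : Fin M₀ → Fin M₁, f c₀ = c₁ ∧
    (∀ a, dist (h a) (h c₀) ≤ 63 / 10 + τ → h a - h c₀ = z₁ (f a) - z₁ c₁) ∧
    (∀ a b, dist (h a) (h c₀) ≤ 63 / 10 + τ → dist (h b) (h c₀) ≤ 63 / 10 + τ → f a = f b → a = b) ∧
    (∀ b₁, dist (z₁ b₁) (z₁ c₁) ≤ 6 → ∃ a, dist (h a) (h c₀) ≤ 63 / 10 - τ ∧ f a = b₁)

/-- Every reference rides on itself (labelling `id`; tolerance `τ ≤ 3/10`) — in particular `RidesOn z₁ c₁ τ` is satisfiable [V2 witness]. [formal bookkeeping] -/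
theorem ridesOn_self (z₁ : Fin M₁ → E3) (c₁ : Fin M₁) (hτ : τ ≤ 3 / 10) : RidesOn z₁ c₁ τ M₁ z₁ c₁ :=
  ⟨id, rfl, fun _ _ => rfl, fun _ _ _ _ h => h, fun b₁ hb₁ => ⟨b₁, by linarith, rfl⟩⟩

/-- ★ THE COMPOSITION IN FRAME CURRENCY: a position chart (`ChartBy`, tolerance `τ`) by an instance riding exactly on the reference is a FRAME chart by the
reference with the SAME tolerance `τ` — nothing is lost (compare 61H's `bondChart_of_chartBy_of_nearRef`: pair tolerance `2τ`, orientation forgotten). [folklore] -/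
theorem frameChart_of_chartBy_of_ridesOn (hch : ChartBy 𝓘 τ t z c h c₀ e) (hr : RidesOn z₁ c₁ τ M₀ h c₀) :
    ∃ e' : Fin M → Fin M₁, FrameChart τ z c z₁ c₁ e' := by
  obtain ⟨f, hfc, hvec, hinj, hcov⟩ := hr
  refine ⟨fun a => f (e a), ?_, fun a ha => ?_, fun a b ha hb hab => ?_, fun b₁ hb₁ => ?_⟩
  · show f (e c) = c₁
    rw [hch.2.1, hfc]
  · have h₁ := hch.2.2.1 a ha
    have h₂ := hvec (e a) (chartBy_inst_ball hch ha)
    show dist (z a - z c) (z₁ (f (e a)) - z₁ c₁) ≤ τ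
    rw [← h₂]
    exact h₁
  · exact hch.2.2.2.2.1 a b ha hb (hinj (e a) (e b) (chartBy_inst_ball hch ha) (chartBy_inst_ball hch hb) hab)
  · obtain ⟨a₀, ha₀, hfa₀⟩ := hcov b₁ hb₁
    obtain ⟨a, ha, hea⟩ := hch.2.2.2.2.2 a₀ ha₀
    exact ⟨a, ha, show f (e a) = b₁ by rw [hea, hfa₀]⟩

/-- ★★ THE CELL LEMMA IN FRAME CURRENCY: ONE frame certificate at the reference decides the tube floor over the whole cell `𝓘 ⊓ RidesOn z₁ c₁ τ`. [folklore] -/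
theorem tubeFloor_frameCell (hF : FrameTubeFloor z₁ c₁ τ) : TubeFloor (fun M₀ h c₀ => 𝓘 M₀ h c₀ ∧ RidesOn z₁ c₁ τ M₀ h c₀) τ := by
  intro M z c M₀ h c₀ e hz hcl hm hch
  obtain ⟨e', he'⟩ := frameChart_of_chartBy_of_ridesOn hch hch.1.2
  exact hF M z c e' hz hcl hm he'

end Cell

/-! ### Cells indexed by an arbitrary type (62B: `i = (k, G, ξ, b)` over the boxes; 61H: `i : Fin K`) -/

section Cells
variable {𝓘 : (M₀ : ℕ) → (Fin M₀ → E3) → Fin M₀ → Prop} {I : Type*} {Mc : I → ℕ} {Z : (i : I) → Fin (Mc i) → E3} {C : (i : I) → Fin (Mc i)} {τ : ℝ}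

/-- `InFrameCells Z C τ` — the instances riding exactly on SOME reference of the indexed family `(Z i, C i)`. -/
def InFrameCells {I : Type*} {Mc : I → ℕ} (Z : (i : I) → Fin (Mc i) → E3) (C : (i : I) → Fin (Mc i)) (τ : ℝ) :
    (M₀ : ℕ) → (Fin M₀ → E3) → Fin M₀ → Prop :=
  fun M₀ h c₀ => ∃ i, RidesOn (Z i) (C i) τ M₀ h c₀

/-- **(ECᶠ) `FrameCellsCert Z C τ` [CERTIFICATE: one frame floor per cell · INSTRUMENTABLE]** — (FTᶠ) at every reference of the family. -/
def FrameCellsCert {I : Type*} {Mc : I → ℕ} (Z : (i : I) → Fin (Mc i) → E3) (C : (i : I) → Fin (Mc i)) (τ : ℝ) : Prop :=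
  ∀ i, FrameTubeFloor (Z i) (C i) τ

/-- ★ (ECᶠ) decides the tube floor over the part of any family reached by the cells. [folklore] -/
theorem tubeFloor_of_frameCellsCert (hcert : FrameCellsCert Z C τ) : TubeFloor (fun M₀ h c₀ => 𝓘 M₀ h c₀ ∧ InFrameCells Z C τ M₀ h c₀) τ := by
  intro M z c M₀ h c₀ e hz hcl hm hch
  obtain ⟨i, hi⟩ := hch.1.2
  obtain ⟨e', he'⟩ := frameChart_of_chartBy_of_ridesOn hch hi
  exact hcert i M z c e' hz hcl hm he'

/-- ★★ THE FRAME-CELL THEOREM: (ECᶠ) ∧ the tube floor over the un-reached REMAINDER ⟹ (TF) over the family. [folklore] -/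
theorem tubeFloor_of_frameCells_of_remainder (hcert : FrameCellsCert Z C τ)
    (hrem : TubeFloor (fun M₀ h c₀ => 𝓘 M₀ h c₀ ∧ ¬InFrameCells Z C τ M₀ h c₀) τ) : TubeFloor 𝓘 τ :=
  tubeFloor_split _ (tubeFloor_of_frameCellsCert hcert) hrem

/-- … and when every instance rides on some cell the remainder is empty: (ECᶠ) ∧ (EVᶠ) ⟹ (TF). [folklore] -/
theorem tubeFloor_of_frameCells (hcert : FrameCellsCert Z C τ) (hcov : FamilyLE 𝓘 (InFrameCells Z C τ)) : TubeFloor 𝓘 τ :=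
  tubeFloor_of_frameCells_of_remainder hcert fun _ _ _ M₀ h c₀ _ _ _ _ hch => absurd (hcov M₀ h c₀ hch.1.1) hch.1.2

/-- Bond certificates `FatTubeFloor (Z i) (C i) τ 0 0` at every cell give (ECᶠ). [formal bookkeeping] -/
theorem frameCellsCert_of_fat (h : ∀ i, FatTubeFloor (Z i) (C i) τ 0 0) : FrameCellsCert Z C τ := fun i => frameTubeFloor_of_fatTubeFloor (h i)

end Cells

/-! ### The 62B link over tree notions: a PRESENTED instance rides exactly on any complete listing of its bent lattice window -/

section Presented
variable {φ : Bool} {b₀ : E3 → E3} {G : E3 →L[ℝ] E3} {ξ : E3} {M₀ : ℕ} {h : Fin M₀ → E3} {c₀ : Fin M₀} {M₁ : ℕ} {z₁ : Fin M₁ → E3} {c₁ : Fin M₁}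
  {τ : ℝ}

/-- The bending class of record moves a vector of norm `≤ 14` by at most `59/25` (`(1/200)·14² + (1/2000)·14³ = 2.352`). [formal bookkeeping] -/
theorem norm_le_of_bends0_window14 (hb₀ : b₀ ∈ bends0) {v : E3} (hv : ‖v‖ ≤ 14) : ‖v‖ ≤ ‖b₀ v‖ + 59 / 25 := by
  have h₂ : ‖b₀ v - v‖ ≤ 1 / 200 * ‖v‖ ^ 2 + 1 / 2000 * ‖v‖ ^ 3 := polyBends_disp hb₀ v
  have h₄ : ‖v‖ ≤ ‖b₀ v‖ + ‖b₀ v - v‖ := by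
    calc ‖v‖ = ‖b₀ v - (b₀ v - v)‖ := by rw [sub_sub_cancel]
      _ ≤ ‖b₀ v‖ + ‖b₀ v - v‖ := norm_sub_le _ _
  have h₀ := norm_nonneg v
  have h₅ : ‖v‖ ^ 2 ≤ 14 * 14 := by nlinarith
  have h₆ : ‖v‖ ^ 3 ≤ 14 * 14 * 14 := by nlinarith
  nlinarith

/-- ★★ **EXACT RIDING, FRAME VERSION** (the frame twin of 62B's `nearRefA_exact_of_presented`): an injective instance presented by `(φ, b₀, G, ξ)` on the
`133/10`-window, `b₀ ∈ bends0`, RIDES EXACTLY on every reference whose positions relative to its centre are `b₀ (w a')` for an injective listing `w` of lattice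
vectors of `(φ, G, ξ)` with `w c₁ = 0`, `‖w a'‖ ≤ 14`, containing every lattice vector of norm `≤ 10` (62B: `w = N.ref k G ξ`, reference `bendAt b₀ (N.ref k G ξ)`,
the four clauses = `N.GoodAt k G ξ`).  Tolerance `τ ≤ 3/10`. [folklore] -/
theorem ridesOn_of_presentedBy (hb₀ : b₀ ∈ bends0) (hinj : Function.Injective h) (hP : PresentedBy φ b₀ G ξ (133 / 10) h c₀)
    (w : Fin M₁ → E3) (hw : ∀ a', z₁ a' - z₁ c₁ = b₀ (w a')) (hwinj : Function.Injective w) (hwc : w c₁ = 0) (hw14 : ∀ a', ‖w a'‖ ≤ 14)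
    (hwlat : ∀ a', w a' ∈ latSet φ G ξ) (hcomplete : ∀ v ∈ latSet φ G ξ, ‖v‖ ≤ 10 → ∃ a', w a' = v) (hτ : τ ≤ 3 / 10) :
    RidesOn z₁ c₁ τ M₀ h c₀ := by
  obtain ⟨-, -, z₀, hrange, hab⟩ := hP
  have hmr : ∀ a, z₀ a ∈ homRange φ G ξ (133 / 10) (z₀ c₀) := fun a => by rw [← hrange]; exact ⟨a, rfl⟩
  have hlat : ∀ a, z₀ a - z₀ c₀ ∈ latSet φ G ξ := fun a => (mem_homRange_iff.1 (hmr a)).2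
  have hwin : ∀ a, ‖z₀ a - z₀ c₀‖ ≤ 133 / 10 := fun a => by rw [← dist_eq_norm]; exact (mem_homRange_iff.1 (hmr a)).1
  -- the labelling: the listed index of the site's lattice vector, when listed (else junk)
  let f : Fin M₀ → Fin M₁ := fun a => if hx : ∃ a', w a' = z₀ a - z₀ c₀ then hx.choose else c₁
  have hf : ∀ a a', w a' = z₀ a - z₀ c₀ → f a = a' := by
    intro a a' ha'
    have hx : ∃ a', w a' = z₀ a - z₀ c₀ := ⟨a', ha'⟩
    have h₁ : f a = hx.choose := dif_pos hx
    rw [h₁]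
    exact hwinj (hx.choose_spec.trans ha'.symm)
  have hball : ∀ a, dist (h a) (h c₀) ≤ 63 / 10 + τ → ∃ a', w a' = z₀ a - z₀ c₀ := by
    intro a ha
    have h₁ : ‖b₀ (z₀ a - z₀ c₀)‖ ≤ 63 / 10 + τ := by rw [← hab a, ← dist_eq_norm]; exact ha
    have h₂ := norm_le_of_bends0_window14 hb₀ (show ‖z₀ a - z₀ c₀‖ ≤ 14 by linarith [hwin a])
    exact hcomplete _ (hlat a) (by linarith)
  refine ⟨f, ?_, fun a ha => ?_, fun a b ha hb hfab => ?_, fun b₁ hb₁ => ?_⟩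
  · exact hf c₀ c₁ (by rw [hwc, sub_self])
  · obtain ⟨a', ha'⟩ := hball a ha
    rw [hf a a' ha', hw a', ha', hab a]
  · obtain ⟨a', ha'⟩ := hball a ha
    obtain ⟨b', hb'⟩ := hball b hb
    rw [hf a a' ha', hf b b' hb'] at hfab
    apply hinj
    have h₁ : h a - h c₀ = h b - h c₀ := by rw [hab a, hab b, ← ha', ← hb', hfab]
    exact sub_left_injective h₁
  · -- the reference site `b₁` of the `6`-ball is the image of an instance site of the `6`-ball
    have h₁ : ‖b₀ (w b₁)‖ ≤ 6 := by rw [← hw b₁, ← dist_eq_norm]; exact hb₁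
    have h₃ : ‖w b₁‖ ≤ 133 / 10 := by linarith [norm_le_of_bends0_window14 hb₀ (hw14 b₁)]
    have hx : z₀ c₀ + w b₁ ∈ homRange φ G ξ (133 / 10) (z₀ c₀) :=
      mem_homRange_iff.2 ⟨by rwa [dist_eq_norm, add_sub_cancel_left], by rw [add_sub_cancel_left]; exact hwlat b₁⟩
    rw [← hrange] at hx
    obtain ⟨a, ha⟩ := hx
    have ha' : w b₁ = z₀ a - z₀ c₀ := by rw [ha, add_sub_cancel_left]
    refine ⟨a, ?_, hf a b₁ ha'⟩
    rw [dist_eq_norm, hab a, ← ha']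
    linarith

end Presented

end Summit.AtomisticToContinuum.Crystallization.Theorems.FrustratedLawDichotomyStrainedPatchFrameCells
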